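import Mathlib
import HarnessLib
import Literature.Computability.AlgebraicComplexity.PatternExpressions
import Literature.Combinatorics.SimpleGraph.TreeDecomposition
import Summits.ValiantsHypothesis.ValiantsHypothesis.Theorems.MonotoneRestorationMonotoneRestorationQPLinearWidthAffinePencil

/-!
# Route MonotoneRestoration, crux `MonotoneRestorationQP` (stmt-15886), line `linear-width` —
# DETERMINED POLYNOMIALS FORM A GRADED SUBALGEBRA: homogeneous components of a polynomial determined by
# `HomIndist n k` are determined by `HomIndist n k`

Helper file (`--supports stmt-ValiantsHypothesis-15886`), def-free; sequel of
`Theorems/…LinearWidthAffinePencil.lean`.  The level-`n` clause of the width hypothesis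
`PolylogHomDetermined` of `WidthRung d` says that `p = f n` is DETERMINED by `HomIndist n k`.  The set of
such polynomials is obviously a subalgebra; this file certifies that it is GRADED — closed under taking
homogeneous components — by the scaling line `s ↦ s·A` of the affine pencil (`AffinePencil.homIndist_affine`
with `t = 0`) and the identity theorem for univariate polynomials:

* `eval_smul_eq_sum_homogeneousComponent` — `p(s·A) = Σ_d s^d · p_d(A)` (`p_d` the homogeneous
  components);
* `eval_homogeneousComponent_eq_of_determined` — if `p` is determined by `HomIndist n k` then so is
  every `p_d`;
so the open question behind `stub_linearDegreeWidthRestoration` / K1 ("determined ⇒ narrow?") may be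
asked degree by degree, and the degree hypothesis of `WidthRung d` can be imposed on homogeneous
components without loss.  Honest label: structural calibration; no stub closed; VP ≠ VNP not moved.
[cite: DwivediPagoSeppelt2026, Def. 3.2]
-/

-- `Summit.ValiantsHypothesis.ValiantsHypothesis.…` is the tree's mandated namespace (Sub = Summit).
set_option linter.dupNamespace false

noncomputable section

namespace Summit.ValiantsHypothesis.ValiantsHypothesis.Theorems

namespace AffinePencil

open Literature.Computability.AlgebraicComplexity MvPolynomial

variable {n : ℕ}

/-! ### Scaling and homogeneous components -/

/-- Scaling the point scales a homogeneous polynomial of degree `d` by `s^d`. [folklore] -/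
theorem eval_smul_of_isHomogeneous {ι : Type*} {q : MvPolynomial ι ℂ} {d : ℕ}
    (hq : q.IsHomogeneous d) (A : ι → ℂ) (s : ℂ) :
    eval (fun i => s * A i) q = s ^ d * eval A q := by
  classical
  rw [MvPolynomial.eval_eq, MvPolynomial.eval_eq, Finset.mul_sum]
  refine Finset.sum_congr rfl fun m hm => ?_
  have hdeg : ∑ i ∈ m.support, m i = d := by
    have := hq (mem_support_iff.1 hm)
    simpa [Finsupp.weight_apply, Finsupp.sum] using this
  rw [Finset.prod_congr rfl fun i _ => mul_pow s (A i) (m i), Finset.prod_mul_distrib,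
    Finset.prod_pow_eq_pow_sum, hdeg]
  ring

/-- **`p(s·A) = Σ_d s^d · p_d(A)`** over the homogeneous components `p_d`. [folklore] -/
theorem eval_smul_eq_sum_homogeneousComponent {ι : Type*} (p : MvPolynomial ι ℂ) (A : ι → ℂ)
    (s : ℂ) :
    eval (fun i => s * A i) p =
      ∑ d ∈ Finset.range (p.totalDegree + 1), s ^ d * eval A (homogeneousComponent d p) := by
  conv_lhs => rw [← sum_homogeneousComponent p]
  rw [map_sum]
  exact Finset.sum_congr rfl fun d _ =>
    eval_smul_of_isHomogeneous (homogeneousComponent_isHomogeneous d p) A s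

/-- Identity theorem: a finite power sum `Σ_{d<N} s^d c_d` vanishing for all `s ∈ ℂ` has all
`c_d = 0`. [folklore] -/
theorem coeff_eq_zero_of_forall_sum_pow_mul_eq_zero {N : ℕ} (c : ℕ → ℂ)
    (h : ∀ s : ℂ, ∑ d ∈ Finset.range N, s ^ d * c d = 0) : ∀ d < N, c d = 0 := by
  let P : Polynomial ℂ := ∑ d ∈ Finset.range N, Polynomial.monomial d (c d)
  have hP : P = 0 := by
    apply Polynomial.funext
    intro s
    simp only [P, Polynomial.eval_finsetSum, Polynomial.eval_monomial, Polynomial.eval_zero]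
    simpa [mul_comm] using h s
  intro d hd
  have := congr_arg (fun Q : Polynomial ℂ => Q.coeff d) hP
  simpa [P, Polynomial.finsetSum_coeff, Polynomial.coeff_monomial, Finset.mem_range, hd] using this

/-- **Homogeneous components of a determined polynomial are determined.**  If `p` takes equal values
at any two points hom-indistinguishable below treewidth `k` (`HomIndist n k` of line `linear-width`,
unfolded verbatim), then so does each homogeneous component of `p`. [folklore] -/
theorem eval_homogeneousComponent_eq_of_determined {k : ℕ} (p : MvPolynomial (Fin n × Fin n) ℂ)
    (hp : ∀ A B : Fin n × Fin n → ℂ,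
      (∀ (a b : ℕ) (E : Multiset (Fin a × Fin b)),
        Literature.Combinatorics.SimpleGraph.treewidth
          (SimpleGraph.fromRel fun u v : Fin a ⊕ Fin b => ∃ p ∈ E, u = Sum.inl p.1 ∧ v = Sum.inr p.2) < k →
        eval A (homPoly E n ℂ) = eval B (homPoly E n ℂ)) →
      eval A p = eval B p)
    (d : ℕ) (A B : Fin n × Fin n → ℂ)
    (hind : ∀ (a b : ℕ) (E : Multiset (Fin a × Fin b)),
      Literature.Combinatorics.SimpleGraph.treewidth
        (SimpleGraph.fromRel fun u v : Fin a ⊕ Fin b => ∃ p ∈ E, u = Sum.inl p.1 ∧ v = Sum.inr p.2) < k →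
      eval A (homPoly E n ℂ) = eval B (homPoly E n ℂ)) :
    eval A (homogeneousComponent d p) = eval B (homogeneousComponent d p) := by
  -- along the scaling line the values agree
  have hline : ∀ s : ℂ, eval (fun ij => s * A ij) p = eval (fun ij => s * B ij) p := by
    intro s
    have h := eval_eq_affine_of_determined p hp A B hind s 0
    simpa using h
  -- compare coefficients of `s^d`
  have hcoef := coeff_eq_zero_of_forall_sum_pow_mul_eq_zero (N := p.totalDegree + 1)
    (fun d => eval A (homogeneousComponent d p) - eval B (homogeneousComponent d p)) (fun s => by
      simp only [mul_sub, Finset.sum_sub_distrib, ← eval_smul_eq_sum_homogeneousComponent, hline s,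
        sub_self])
  by_cases hd : d < p.totalDegree + 1
  · exact sub_eq_zero.1 (hcoef d hd)
  · rw [homogeneousComponent_eq_zero d p (by omega)]
    simp

end AffinePencil

end Summit.ValiantsHypothesis.ValiantsHypothesis.Theorems

end
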